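import Literature.AlgebraicGeometry.HodgeTheory.WeilFamilyFlatSections
import Literature.AlgebraicGeometry.Motives.AbelianVarietyKernelDimension
import Literature.AlgebraicGeometry.Motives.AbelianVarietyLie
import Literature.AlgebraicGeometry.Motives.AbelianVarietyProductDimProofs
import Literature.NumberTheory.DiophantineGeometry.AVIsogenyFlat
import HarnessLib

/-!
# The Weil family through an abelian variety of Weil type, proofs I: the tensor-split fibre

Sibling proof file of `WeilFamilyFlatSections` (named facts
`deligne1982_weilFamily_flatWeilSection`, `deligne1982_weilFamily_hodgeWeilSection`: Deligne's
polarized `ℚ(√-p)`-Weil family through `X` with a flat Weil section and a TENSOR-SPLIT fibre,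
[Deligne1982HodgeCycles, proof of Thm. 4.8, pp. 48–51]). Those facts are a THEORY away from the
tree (no moduli of polarized abelian varieties, no universal abelian scheme, no Baily–Borel; see the
module docstring there); this file proves, on the tree's real carriers, the one sentence of the
package that is not printed verbatim in the sources — the algebra behind its last clause:

> the special fibre `Y` (with `Ψ`, `Ψ ≫ Ψ = -p`) admits an ISOGENY PAIR towards a tensor point
> `(A₁ × A₁, (x, y) ↦ (-p·y, x))`: `f₁ : Y ⟶ A₁ × A₁` flat, `g₁ : A₁ × A₁ ⟶ Y`,
> `f₁ ≫ g₁ = m • 𝟙 Y`, `0 < m`, `g₁ ≫ Ψ = companion ≫ g₁`.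

In every component of the Weil family (every discriminant) the special fibre is the DIAGONAL CM
POINT: an abelian variety `K`-isogenous to `E_K^{2k} = B × B`, `B = E_K^k`, with `√-p` acting by
`diag(ι_B, -ι_B)`, `ι_B ≫ ι_B = -p` ([vanGeemen1994HodgeAV, 5.4–5.7]: Landherr normal form of the
`K`-Hermitian form; [Andre1996Motifs, Lemme 6.3.3]: "Landherr + puissances d'une courbe
elliptique à multiplication complexe"; [Deligne1982HodgeCycles, Prop. 4.1 and p. 50–51]). The
passage from the diagonal point to the tensor point is the isogeny
`E_K ⊗_ℤ ℤ[√-p] → E_K × E_K`, `x ⊗ 1 ↦ (x, x)`, `x ⊗ √-p ↦ (ιx, -ιx)`, i.e. on `B × B`: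

* `g_T = companionToDiag ι : (x, y) ↦ (x + ι y, x - ι y)` (tensor side → diagonal side),
* `f_T = diagToCompanion ι p : (u, v) ↦ (p (u + v), ι (v - u))` (diagonal side → tensor side),

with `f_T ≫ g_T = 2p = g_T ≫ f_T` (`diagToCompanion_comp_companionToDiag`,
`companionToDiag_comp_diagToCompanion`) and `g_T ≫ diag = companion ≫ g_T`
(`companionToDiag_comp_diagEnd`) — pure bilinear algebra in the preadditive category of abelian
varieties (Mumford, *Abelian Varieties*, §19), valid over any field; `f_T` is an isogeny
(`isIsogeny_diagToCompanion`: `g_T ≫ f_T = [2p]` is surjective for `2p ≠ 0` in the field, so `f_T`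
is a surjective endomorphism, `Motives.AbelianVariety.isIsogeny_of_surjective_end`), hence FLAT
(`flat_diagToCompanion`, the tree's proved `IsIsogeny.flat_toSchemeHom_holds`, Görtz–Wedhorn II
Prop. 27.54). Composing with any `K`-isogeny pair `(α, β)` between `(Y, Ψ)` and `(B × B, diag)`
gives the clause verbatim (`tensorSplit_of_isogenyPair_diag`, `m = 2p·m₁`). What remains for the
named facts is thus exactly the printed content: the family, the flat Weil section, and a fibre
`K`-isogenous to the diagonal CM point.

No new definitions of notions and no named facts are introduced (four `abbrev`s name the
endomorphisms `companionEnd`, `diagEnd`, `companionToDiag`, `diagToCompanion` of `B × B`).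

## References

* [Deligne1982HodgeCycles] P. Deligne (notes by J. S. Milne), Hodge cycles on abelian varieties,
  in LNM 900 (1982), Prop. 4.1, Cor. 4.2, proof of Thm. 4.8 (pp. 48–51), Remark 4.10.
* [vanGeemen1994HodgeAV] B. van Geemen, An introduction to the Hodge conjecture for abelian
  varieties, in LNM 1594 (1994), 5.3–5.11.
* [Andre1996Motifs] Y. André, Pour une théorie inconditionnelle des motifs, Publ. Math. IHÉS 83
  (1996), Lemme 6.3.3 and its proof.
* [MumfordAV1970] D. Mumford, Abelian Varieties, §19 (bilinearity of composition).
* [GortzWedhorn2023] U. Görtz, T. Wedhorn, Algebraic Geometry II, Prop. 27.54, 27.176 (isogenies).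
-/

noncomputable section

open CategoryTheory AlgebraicGeometry

universe u

namespace Literature.AlgebraicGeometry.HodgeTheory

namespace WeilFamily

open Motives Motives.AbelianVariety

section Algebra

variable {K : Type u} [Field K] (B : Motives.AbelianVariety K)

/-- The **companion endomorphism** `(x, y) ↦ (-p·y, x)` of `B × B` — the action of `1 ⊗ √-p` on
the tensor point `B ⊗_ℤ ℤ[√-p] = B × B` in the basis `1, √-p` (companion matrix of `T² + p`); this is
literally the endomorphism in the last clause of `deligne1982_weilFamily_flatWeilSection`.
[cite: Deligne1982HodgeCycles, Lemma 4.5 and Remark 4.10] -/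
abbrev companionEnd (p : ℕ) : B.prod B ⟶ B.prod B :=
  prodLift (snd B B ≫ (-((p : ℤ) • 𝟙 B))) (fst B B)

variable {B}

/-- The **diagonal endomorphism** `(x, y) ↦ (ι x, -ι y)` of `B × B` for `ι : B ⟶ B` — `√-p` acting
on the diagonal CM point `E_K^k × E_K^k` by `diag(ι, ῑ)`, `ῑ = -ι`.
[cite: vanGeemen1994HodgeAV, 5.4–5.7] [cite: Andre1996Motifs, Lemme 6.3.3] -/
abbrev diagEnd (ι : B ⟶ B) : B.prod B ⟶ B.prod B :=
  prodLift (fst B B ≫ ι) (snd B B ≫ (-ι))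

/-- `g_T : (x, y) ↦ (x + ι y, x - ι y)`, the isogeny `B ⊗ ℤ[√-p] → B × B`, `x ⊗ α ↦ (αx, ᾱx)`
(tensor point → diagonal point). [cite: Andre1996Motifs, proof of Lemme 6.3.3] -/
abbrev companionToDiag (ι : B ⟶ B) : B.prod B ⟶ B.prod B :=
  prodLift (fst B B + snd B B ≫ ι) (fst B B - snd B B ≫ ι)

/-- `f_T : (u, v) ↦ (p (u + v), ι (v - u))`, a quasi-inverse of `g_T` (diagonal point → tensor
point): `f_T ≫ g_T = 2p = g_T ≫ f_T` when `ι ≫ ι = -p`. [cite: Andre1996Motifs, proof of Lemme 6.3.3] -/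
abbrev diagToCompanion (ι : B ⟶ B) (p : ℕ) : B.prod B ⟶ B.prod B :=
  prodLift ((p : ℤ) • (fst B B + snd B B)) ((snd B B - fst B B) ≫ ι)

variable {ι : B ⟶ B} {p : ℕ}

/-- `f_T ≫ g_T = 2p`: `g_T (f_T (u, v)) = (p(u+v) + ι²(v-u), p(u+v) - ι²(v-u)) = (2p u, 2p v)` for
`ι² = -p` (bilinearity of composition, Mumford §19). [cite: MumfordAV1970, §19] -/
theorem diagToCompanion_comp_companionToDiag (hι : ι ≫ ι = -((p : ℤ) • 𝟙 B)) :
    diagToCompanion ι p ≫ companionToDiag ι = (2 * (p : ℤ)) • 𝟙 (B.prod B) := by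
  apply prod_hom_ext
  · simp only [Category.assoc, prodLift_fst, Preadditive.comp_add, prodLift_snd_assoc, hι,
      Preadditive.comp_neg, Preadditive.comp_zsmul, Category.comp_id, Preadditive.zsmul_comp,
      Category.id_comp]
    module
  · simp only [Category.assoc, prodLift_snd, Preadditive.comp_sub, prodLift_fst, prodLift_snd_assoc,
      hι, Preadditive.comp_neg, Preadditive.comp_zsmul, Category.comp_id, Preadditive.zsmul_comp,
      Category.id_comp]
    module

/-- `g_T ≫ f_T = 2p`: `f_T (g_T (x, y)) = (p · 2x, ι(-2ιy)) = (2p x, 2p y)` for `ι² = -p`.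
[cite: MumfordAV1970, §19] -/
theorem companionToDiag_comp_diagToCompanion (hι : ι ≫ ι = -((p : ℤ) • 𝟙 B)) :
    companionToDiag ι ≫ diagToCompanion ι p = (2 * (p : ℤ)) • 𝟙 (B.prod B) := by
  apply prod_hom_ext
  · simp only [Category.assoc, prodLift_fst, Preadditive.comp_zsmul, Preadditive.comp_add,
      prodLift_snd, Preadditive.zsmul_comp, Category.id_comp]
    module
  · simp only [Category.assoc, prodLift_snd, Preadditive.sub_comp, Preadditive.comp_sub,
      prodLift_snd_assoc, prodLift_fst_assoc, Preadditive.add_comp, hι, Preadditive.comp_neg,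
      Preadditive.comp_zsmul, Category.comp_id, Preadditive.zsmul_comp, Category.id_comp]
    module

/-- **`g_T` intertwines the companion action with the diagonal one**: `g_T ≫ diag = companion ≫ g_T`,
i.e. `diag (g_T (x, y)) = (ιx - p y, -ιx - p y) = g_T (-p y, x)` for `ι² = -p` — the map
`x ⊗ α ↦ (αx, ᾱx)` is `ℤ[√-p]`-linear. [cite: Andre1996Motifs, proof of Lemme 6.3.3] [cite: MumfordAV1970, §19] -/
theorem companionToDiag_comp_diagEnd (hι : ι ≫ ι = -((p : ℤ) • 𝟙 B)) :
    companionToDiag ι ≫ diagEnd ι = companionEnd B p ≫ companionToDiag ι := by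
  apply prod_hom_ext
  · simp only [Category.assoc, prodLift_fst, prodLift_fst_assoc, Preadditive.add_comp, hι,
      Preadditive.comp_neg, Preadditive.comp_zsmul, Category.comp_id, Preadditive.comp_add,
      prodLift_snd_assoc]
    module
  · simp only [Category.assoc, prodLift_snd, prodLift_snd_assoc, Preadditive.comp_neg,
      Preadditive.sub_comp, hι, Preadditive.comp_zsmul, Category.comp_id, Preadditive.comp_sub,
      prodLift_fst]
    module

/-- `diag ≫ diag = -p`: `(ι²x, (-ι)²y) = (-p x, -p y)` for `ι² = -p` — the diagonal CM point is a
`√-p`-abelian variety in the typing of the named facts. [cite: MumfordAV1970, §19] -/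
theorem diagEnd_comp_diagEnd (hι : ι ≫ ι = -((p : ℤ) • 𝟙 B)) :
    diagEnd ι ≫ diagEnd ι = -((p : ℤ) • 𝟙 (B.prod B)) := by
  apply prod_hom_ext
  · simp only [Category.assoc, prodLift_fst, prodLift_fst_assoc, hι, Preadditive.comp_neg,
      Preadditive.comp_zsmul, Category.comp_id, Preadditive.neg_comp, Preadditive.zsmul_comp,
      Category.id_comp]
  · simp only [Category.assoc, prodLift_snd, prodLift_snd_assoc, Preadditive.comp_neg,
      Preadditive.neg_comp, hι, Preadditive.comp_zsmul, Category.comp_id, neg_neg,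
      Preadditive.zsmul_comp, Category.id_comp]

/-- **`f_T` is an isogeny** when `2p ≠ 0` in `K`: `g_T ≫ f_T = [2p]` is surjective
(`Motives.AbelianVariety.isIsogeny_zsmul_id_of_cast_ne_zero`), so the endomorphism `f_T` of `B × B`
is surjective, hence an isogeny (`Motives.AbelianVariety.isIsogeny_of_surjective_end`; Milne 1986,
Prop. 8.1). [cite: GortzWedhorn2023, Prop. 27.176 and Prop. 27.187] -/
theorem isIsogeny_diagToCompanion (hι : ι ≫ ι = -((p : ℤ) • 𝟙 B)) (h2p : ((2 * (p : ℤ) : ℤ) : K) ≠ 0) :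
    IsIsogeny (diagToCompanion ι p) := by
  have hiso : IsIsogeny ((2 * (p : ℤ)) • 𝟙 (B.prod B)) :=
    isIsogeny_zsmul_id_of_cast_ne_zero (A := B.prod B) (2 * (p : ℤ)) h2p
  have hsurj : Surjective (Hom.toSchemeHom (companionToDiag ι ≫ diagToCompanion ι p)) := by
    rw [companionToDiag_comp_diagToCompanion hι]
    exact hiso.1
  haveI : Surjective (Hom.toSchemeHom (companionToDiag ι) ≫ Hom.toSchemeHom (diagToCompanion ι p)) :=
    hsurj
  haveI : Surjective (Hom.toSchemeHom (diagToCompanion ι p)) :=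
    Surjective.of_comp (f := Hom.toSchemeHom (companionToDiag ι)) (g := Hom.toSchemeHom (diagToCompanion ι p))
  exact isIsogeny_of_surjective_end _

/-- **`f_T` is flat** (isogenies are finite locally free: the tree's proved
`IsIsogeny.flat_toSchemeHom_holds`, Görtz–Wedhorn II Prop. 27.54). [cite: GortzWedhorn2023, Prop. 27.54] -/
theorem flat_diagToCompanion (hι : ι ≫ ι = -((p : ℤ) • 𝟙 B)) (h2p : ((2 * (p : ℤ) : ℤ) : K) ≠ 0) :
    Flat (Hom.toSchemeHom (diagToCompanion ι p)) :=
  IsIsogeny.flat_toSchemeHom_holds (isIsogeny_diagToCompanion hι h2p)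

end Algebra

/-! ### The tensor-split clause from a `K`-isogeny pair to the diagonal CM point -/

section TensorSplit

open Motives Motives.AbelianVariety

/-- **The last clause of `deligne1982_weilFamily_flatWeilSection` / `…_hodgeWeilSection` from the
diagonal CM point.** Let `(Y, Ψ)`, `Ψ ≫ Ψ = -p`, be a complex abelian `2k`-fold with an ISOGENY PAIR
towards `(B × B, diag(ι, -ι))` for an abelian `k`-fold `B` with `ι ≫ ι = -p` — `α : Y ⟶ B × B` flat,
`β : B × B ⟶ Y`, `α ≫ β = m₁ • 𝟙 Y`, `0 < m₁`, `β ≫ Ψ = diag ≫ β` (in the Weil family: the fibre at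
the CM point is `K`-isogenous to `E_K^{2k}`, [vanGeemen1994HodgeAV, 5.4–5.7],
[Andre1996Motifs, Lemme 6.3.3]). Then `(Y, Ψ)` has an isogeny pair towards the TENSOR POINT
`(B × B, (x,y) ↦ (-p·y, x))` in the exact typing of the named facts: `f₁ = α ≫ f_T`, `g₁ = g_T ≫ β`,
`m = 2p·m₁` (`f_T ≫ g_T = 2p`, `g_T ≫ diag = companion ≫ g_T`, `f_T` flat).
[cite: Deligne1982HodgeCycles, proof of Thm. 4.8 (pp. 50–51) and Remark 4.10]
[cite: Andre1996Motifs, Lemme 6.3.3] -/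
theorem tensorSplit_of_isogenyPair_diag {p k : ℕ} (hp : p ≠ 0)
    {Y B : Motives.AbelianVariety ℂ} {Ψ : Y ⟶ Y} {ι : B ⟶ B}
    (hY : Y.dim = 2 * k) (hB : B.dim = k)
    (hΨ : Ψ ≫ Ψ = -((p : ℤ) • 𝟙 Y)) (hι : ι ≫ ι = -((p : ℤ) • 𝟙 B))
    (α : Y ⟶ B.prod B) (β : B.prod B ⟶ Y) {m₁ : ℕ} (hm₁ : 0 < m₁)
    (hαβ : α ≫ β = m₁ • 𝟙 Y) (hα : Flat (Hom.toSchemeHom α))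
    (hβ : β ≫ Ψ = WeilFamily.diagEnd ι ≫ β) :
    ∃ (A₁ : Motives.AbelianVariety ℂ) (f₁ : Y ⟶ A₁.prod A₁) (g₁ : A₁.prod A₁ ⟶ Y) (m : ℕ),
      A₁.dim = k ∧ Y.dim = 2 * k ∧ Ψ ≫ Ψ = -((p : ℤ) • 𝟙 Y) ∧ 0 < m ∧
      f₁ ≫ g₁ = m • 𝟙 Y ∧ Flat f₁.hom.hom.hom.left ∧
      g₁ ≫ Ψ = Motives.AbelianVariety.prodLift
        (Motives.AbelianVariety.snd A₁ A₁ ≫ (-((p : ℤ) • 𝟙 A₁)))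
        (Motives.AbelianVariety.fst A₁ A₁) ≫ g₁ := by
  have h2p : ((2 * (p : ℤ) : ℤ) : ℂ) ≠ 0 := by
    have : (p : ℂ) ≠ 0 := Nat.cast_ne_zero.mpr hp
    push_cast
    exact mul_ne_zero two_ne_zero this
  haveI : Flat (Hom.toSchemeHom α) := hα
  haveI : Flat (Hom.toSchemeHom (WeilFamily.diagToCompanion ι p)) :=
    WeilFamily.flat_diagToCompanion hι h2p
  refine ⟨B, α ≫ WeilFamily.diagToCompanion ι p, WeilFamily.companionToDiag ι ≫ β, 2 * p * m₁,
    hB, hY, hΨ, by positivity, ?_, ?_, ?_⟩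
  · -- `f₁ ≫ g₁ = α ≫ (f_T ≫ g_T) ≫ β = α ≫ (2p) ≫ β = 2p·m₁`
    rw [Category.assoc, ← Category.assoc (WeilFamily.diagToCompanion ι p),
      WeilFamily.diagToCompanion_comp_companionToDiag hι, Preadditive.zsmul_comp, Category.id_comp,
      Preadditive.comp_zsmul, hαβ, ← natCast_zsmul, ← natCast_zsmul, smul_smul]
    push_cast
    ring_nf
  · -- flatness of the composite `α ≫ f_T`
    change Flat (Hom.toSchemeHom α ≫ Hom.toSchemeHom (WeilFamily.diagToCompanion ι p))
    infer_instance
  · -- `g₁ ≫ Ψ = g_T ≫ β ≫ Ψ = g_T ≫ diag ≫ β = companion ≫ g_T ≫ β`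
    rw [Category.assoc, hβ, ← Category.assoc, WeilFamily.companionToDiag_comp_diagEnd hι,
      Category.assoc]

/-- **Non-vacuity / the diagonal CM point itself**: `(B × B, diag(ι, -ι))`, `B` an abelian `k`-fold
with `ι ≫ ι = -p`, `p ≠ 0`, satisfies the tensor-split clause of the named facts (isogeny pair
`(f_T, g_T)` towards `(B × B, companion)`, `m = 2p`): the case `α = β = 𝟙` of
`tensorSplit_of_isogenyPair_diag`. [cite: Andre1996Motifs, Lemme 6.3.3]
[cite: Deligne1982HodgeCycles, Remark 4.10] -/
theorem tensorSplit_diag {p k : ℕ} (hp : p ≠ 0) {B : Motives.AbelianVariety ℂ} {ι : B ⟶ B}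
    (hB : B.dim = k) (hι : ι ≫ ι = -((p : ℤ) • 𝟙 B)) :
    ∃ (A₁ : Motives.AbelianVariety ℂ) (f₁ : B.prod B ⟶ A₁.prod A₁) (g₁ : A₁.prod A₁ ⟶ B.prod B)
      (m : ℕ),
      A₁.dim = k ∧ (B.prod B).dim = 2 * k ∧
      WeilFamily.diagEnd ι ≫ WeilFamily.diagEnd ι = -((p : ℤ) • 𝟙 (B.prod B)) ∧ 0 < m ∧
      f₁ ≫ g₁ = m • 𝟙 (B.prod B) ∧ Flat f₁.hom.hom.hom.left ∧
      g₁ ≫ WeilFamily.diagEnd ι = Motives.AbelianVariety.prodLift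
        (Motives.AbelianVariety.snd A₁ A₁ ≫ (-((p : ℤ) • 𝟙 A₁)))
        (Motives.AbelianVariety.fst A₁ A₁) ≫ g₁ := by
  have hdim : (B.prod B).dim = 2 * k := by rw [dim_prod, hB]; ring
  refine tensorSplit_of_isogenyPair_diag hp hdim hB (WeilFamily.diagEnd_comp_diagEnd hι) hι
    (𝟙 _) (𝟙 _) (m₁ := 1) one_pos ?_ ?_ ?_
  · rw [Category.comp_id, one_smul]
  · change Flat (𝟙 _)
    infer_instance
  · rw [Category.id_comp, Category.comp_id]

end TensorSplit

end WeilFamily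

end Literature.AlgebraicGeometry.HodgeTheory

end
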